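import Mathlib
import Summits.KontsevichZagierPeriods.Zeta5Search.BrickPhiFour

/-!
# BrickPhiTaylor — LEMMA Φ4/Φ5 coefficientwise: `Φ_{n,p}(−j+T) ≡ 1 + λ_p·Q_{n,j}(T) (mod p⁴ ℤ_(p)[[T]])`,
`Q_{n,j}(T) = q_n(j) + (A−2B)·n·T·(2j − n − T)` — the Taylor coefficients of the Frobenius factor of the
brick kernel at a digit point (cell zeta5-irr)

HONEST FRAMING: systematic search; no irrationality claim unless certified. INSTRUMENT lemma of the ζ(5)
census cell zeta5-irr (HOME `run/shared/lean/pub/zeta5-irr/`; memo `zi-p2/LEMMAS.md` §B8-a THEOREM 2 (ii)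
«Φ_{n,p}(−j+T) ≡ 1 (mod p³) coefficientwise», consumed by §B8-a″ THEOREM 5 Step B: «φ_0 = Φ(−j) ≡ 1 mod p³,
φ_m ∈ p³ℤ_(p) for m ≥ 1», `φ_m` = Taylor coefficients of `Φ` at `−j`). Nothing here is about ζ(5); no irrationality
content; filing moves no rung. Filed by the engine seat zi-eng (g7); sequel of `BrickPhiFour`/`BrickPhiFive` (`T = 0`).

## The statement

`p ≥ 5` prime, `2B ≤ A`, `n ∈ ℕ`, `j ∈ ℤ`, `Φ_{n,p}` = `BrickKernelFrobenius.brickPhi`. As a rational function of `T`,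
`Φ_{n,p}(−j+T) = N(T)/D(T)`, `N = W^{A−2B}·∏_{p∤ℓ≤np}(jp+ℓ−pT)^B·∏((n−j)p+ℓ+pT)^B`, `D = ∏(ℓ−jp+pT)^A ∈ ℤ[T]`
(`phiNum`, `phiDen`, `brickPhi_neg_add_eq`; the sign `(−1)^{n(p−1)B} = +1` is absorbed; `D(0)` is prime to `p`,
`not_dvd_phiDen_coeff_zero`). Every product is a product of complete residue blocks `∏_{0<r<p}(p·q_b(T) + r)`,
`q_b(T) = c + b ± T`, and the block laws hold for polynomial arguments (tree `Ljunggren.block_congruence_pow_four`: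
`∏_{0<r<p}(pq + r) ≡ (p−1)! + (q²+q)·Λ_p (mod p⁴ℤ[T])`, `Λ_p = p·A_{p−2}`, `p ≥ 5`; `…_pow_five`: mod `p⁵`, `p ≥ 7`),
so the nilpotent algebra of `BrickPhiFour` (`Λ_p² ≡ 0`) gives **`(p−1)!·N(T) ≡ D(T)·((p−1)! + Λ_p·Q(T))
(mod p⁴ℤ[T])`** (`p ≥ 5`; mod `p⁵ℤ[T]` for `p ≥ 7`), `Q = (A−2B)·M_n(0) + B·M_n(j−T) + B·M_n(n−j+T) − A·M_n(−j+T)`,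
`M_n(c) = Σ_{b<n}(c+b)(c+b+1)` (`phiMomentX`) — explicitly **`Q(T) = q_n(j) + (A−2B)·n·T·(2j − n − T)`**
(`phiMomentX_eq`; `q_n(j) = BrickPhiFour.phiMoment A B n j`, LEMMA Φ4's cubic). As `D(0)`, `(p−1)!` are `p`-units,
in `ℤ_(p)[[T]]`: `Φ_{n,p}(−j+T) ≡ 1 + λ_p·Q(T)`, `λ_p = p·H_{p−1}` — `φ_0 ≡ 1 + λ_p q_n(j)`, `φ_1 ≡ λ_p(A−2B)n(2j−n)`,
`φ_2 ≡ −λ_p(A−2B)n`, `φ_m ≡ 0 (m ≥ 3)` mod `p⁴` (`p⁵`); in particular THEOREM 2 (ii) `N ≡ D (mod p³ℤ[T])`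
(`C_pow_three_dvd_phiNum_sub_phiDen`): `φ_m ∈ p³ℤ_(p)`, `m ≥ 1`. Balanced kernels (`A = 2B`): `Q ≡ q_n(j)` constant.

PROVED here (everything; standard axioms): `brickPhi_neg_add_eq`, `not_dvd_phiDen_coeff_zero`, `blockMomentX_eq`,
`phiMomentX_eq`, `phiMomentX_eval_zero`, **`C_dvd_phiNum_sub_of_block`** (generic: polynomial block law modulo `p^k`,
`k ≤ 6`), **`C_pow_four_dvd_phiNum_sub`** (`p ≥ 5`), **`C_pow_five_dvd_phiNum_sub`** (`p ≥ 7`),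
`C_pow_three_dvd_phiNum_sub_phiDen`.
-/

namespace Summit.KontsevichZagierPeriods.Zeta5Search.BrickPhiTaylor

open Finset Nat Polynomial
open Summit.KontsevichZagierPeriods.Zeta5Search.FrobeniusFactorisation (prod_filter_not_dvd_eq_prod_prod
  not_dvd_prod_filter_sub_mul)
open Summit.KontsevichZagierPeriods.Zeta5Search.BrickKernelFrobenius (brickPhi)
open Summit.KontsevichZagierPeriods.Zeta5Search.BrickPhiFour (blockMoment phiMoment)
open Literature.NumberTheory.Congruences

noncomputable section

/-! ## The numerator, the denominator and the moment polynomial of `Φ_{n,p}(−j+T)` -/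

/-- The numerator polynomial `N(T) = W^{A−2B}·∏_{p∤ℓ≤np}(jp+ℓ−pT)^B·∏_{p∤ℓ≤np}((n−j)p+ℓ+pT)^B ∈ ℤ[T]` of
`Φ_{n,p}(−j+T)`, `W = ∏_{p∤ℓ≤np} ℓ`. -/
def phiNum (A B p n : ℕ) (j : ℤ) : ℤ[X] :=
  C (((∏ m ∈ (Icc 1 (n * p)).filter (fun m => ¬ p ∣ m), m : ℕ) : ℤ)) ^ (A - 2 * B) *
    (∏ m ∈ (Icc 1 (n * p)).filter (fun m => ¬ p ∣ m), (C (j * p + (m : ℤ)) - C (p : ℤ) * X)) ^ B *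
    (∏ m ∈ (Icc 1 (n * p)).filter (fun m => ¬ p ∣ m), (C (((n : ℤ) - j) * p + (m : ℤ)) + C (p : ℤ) * X)) ^ B

/-- The denominator polynomial `D(T) = ∏_{p∤ℓ≤np}(ℓ−jp+pT)^A ∈ ℤ[T]` of `Φ_{n,p}(−j+T)`. -/
def phiDen (A p n : ℕ) (j : ℤ) : ℤ[X] :=
  (∏ m ∈ (Icc 1 (n * p)).filter (fun m => ¬ p ∣ m), (C ((m : ℤ) - j * p) + C (p : ℤ) * X)) ^ A

/-- The block moment with a polynomial argument: `M_n(c) = Σ_{b<n}(c+b)(c+b+1) ∈ ℤ[T]` for `c ∈ ℤ[T]`. -/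
def blockMomentX (n : ℕ) (c : ℤ[X]) : ℤ[X] := ∑ b ∈ range n, (c + C (b : ℤ)) * (c + C (b : ℤ) + 1)

/-- The moment polynomial `Q(T) = (A−2B)·M_n(0) + B·M_n(j−T) + B·M_n(n−j+T) − A·M_n(−j+T)` (blocks of `W`, of
`∏(jp+ℓ−pT)`, of `∏((n−j)p+ℓ+pT)` counted `+`, of the denominator `−`, with multiplicity). -/
def phiMomentX (A B n : ℕ) (j : ℤ) : ℤ[X] :=
  C (((A - 2 * B : ℕ) : ℤ)) * blockMomentX n 0 + C (B : ℤ) * blockMomentX n (C j - X) +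
    C (B : ℤ) * blockMomentX n (C ((n : ℤ) - j) + X) - C (A : ℤ) * blockMomentX n (X - C j)

/-- Closed form of the block moment: `M_n(c) = n·c² + n²·c + M_n(0)`. -/
theorem blockMomentX_eq (n : ℕ) (c : ℤ[X]) :
    blockMomentX n c = C (n : ℤ) * c ^ 2 + C ((n : ℤ) ^ 2) * c + C (blockMoment n 0) := by
  unfold blockMomentX blockMoment
  induction n with
  | zero => simp
  | succ n ih =>
    rw [Finset.sum_range_succ, ih, Finset.sum_range_succ]
    simp only [Nat.cast_succ, map_add, map_mul, map_pow, map_one, zero_add, map_sum]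
    ring

/-- **Closed form of the moment polynomial**: `Q(T) = q_n(j) + (A−2B)·n·T·(2j − n − T)`, `q_n(j) = phiMoment A B n j`
(LEMMA Φ4's cubic); for a balanced kernel (`A = 2B`) `Q` is constant. -/
theorem phiMomentX_eq {A B : ℕ} (hAB : 2 * B ≤ A) (n : ℕ) (j : ℤ) :
    phiMomentX A B n j =
      C (phiMoment A B n j) + C (((A - 2 * B : ℕ) : ℤ) * n) * X * (C (2 * j - (n : ℤ)) - X) := by
  have hM : ∀ c : ℤ, blockMoment n c = n * c ^ 2 + (n : ℤ) ^ 2 * c + blockMoment n 0 := by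
    intro c
    unfold blockMoment
    induction n with
    | zero => simp
    | succ n ih =>
      rw [Finset.sum_range_succ, ih, Finset.sum_range_succ]
      push_cast; ring
  unfold phiMomentX phiMoment
  rw [blockMomentX_eq, blockMomentX_eq, blockMomentX_eq, blockMomentX_eq, hM j, hM ((n : ℤ) - j), hM (-j),
    Nat.cast_sub hAB]
  push_cast
  simp only [map_add, map_sub, map_neg, map_mul, map_pow, map_natCast, map_ofNat]
  ring

/-- `Q(0) = q_n(j)`: the constant term of the moment polynomial is LEMMA Φ4's moment `phiMoment A B n j`. -/
theorem phiMomentX_eval_zero {A B : ℕ} (hAB : 2 * B ≤ A) (n : ℕ) (j : ℤ) :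
    (phiMomentX A B n j).eval 0 = phiMoment A B n j := by
  rw [phiMomentX_eq hAB]; simp

section eval

variable {p : ℕ}

/-- `∏_{1≤ℓ≤np, p∤ℓ}(−1) = 1` for an odd prime `p`. -/
private theorem prod_filter_neg_one {R : Type*} [CommRing R] (hp : p.Prime) (h2 : p ≠ 2) (n : ℕ) :
    ∏ _m ∈ (Icc 1 (n * p)).filter (fun m => ¬ p ∣ m), (-1 : R) = 1 := by
  rw [prod_filter_not_dvd_eq_prod_prod hp.pos n (fun _ => (-1 : R))]
  refine Finset.prod_eq_one fun b _ => ?_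
  rw [Finset.prod_const, Nat.card_Icc, show p - 1 + 1 - 1 = p - 1 by omega]
  exact (hp.even_sub_one h2).neg_one_pow

/-- **`Φ_{n,p}(−j+t) = N(t)/D(t)`** for every `t ∈ ℚ` (poles included: both sides are `x/0 = 0` there), `p` an odd
prime. -/
theorem brickPhi_neg_add_eq (hp : p.Prime) (h2 : p ≠ 2) (A B n : ℕ) (j : ℤ) (t : ℚ) :
    brickPhi A B p n (-(j : ℚ) + t) = aeval t (phiNum A B p n j) / aeval t (phiDen A p n j) := by
  have e1 : ∏ m ∈ (Icc 1 (n * p)).filter (fun m => ¬ p ∣ m), ((p : ℚ) * (-(j : ℚ) + t) - (m : ℚ)) =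
      aeval t (∏ m ∈ (Icc 1 (n * p)).filter (fun m => ¬ p ∣ m), (C (j * p + (m : ℤ)) - C (p : ℤ) * X)) := by
    rw [map_prod, ← one_mul (∏ m ∈ (Icc 1 (n * p)).filter (fun m => ¬ p ∣ m),
      aeval t (C (j * p + (m : ℤ)) - C (p : ℤ) * X)), ← prod_filter_neg_one (R := ℚ) hp h2 n,
      ← Finset.prod_mul_distrib]
    refine Finset.prod_congr rfl fun m _ => ?_
    simp only [map_sub, map_mul, aeval_C, aeval_X, algebraMap_int_eq, Int.coe_castRingHom]
    push_cast; ring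
  have e2 : ∏ m ∈ (Icc 1 (n * p)).filter (fun m => ¬ p ∣ m), ((p : ℚ) * (-(j : ℚ) + t) + ((n * p : ℕ) : ℚ) + (m : ℚ))
      = aeval t (∏ m ∈ (Icc 1 (n * p)).filter (fun m => ¬ p ∣ m), (C (((n : ℤ) - j) * p + (m : ℤ)) + C (p : ℤ) * X)) := by
    rw [map_prod]
    refine Finset.prod_congr rfl fun m _ => ?_
    simp only [map_add, map_sub, map_mul, aeval_C, aeval_X, algebraMap_int_eq, Int.coe_castRingHom]
    push_cast; ring
  have e3 : ∏ m ∈ (Icc 1 (n * p)).filter (fun m => ¬ p ∣ m), ((p : ℚ) * (-(j : ℚ) + t) + (m : ℚ))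
      = aeval t (∏ m ∈ (Icc 1 (n * p)).filter (fun m => ¬ p ∣ m), (C ((m : ℤ) - j * p) + C (p : ℤ) * X)) := by
    rw [map_prod]
    refine Finset.prod_congr rfl fun m _ => ?_
    simp only [map_add, map_sub, map_mul, aeval_C, aeval_X, algebraMap_int_eq, Int.coe_castRingHom]
    push_cast; ring
  have eW : (((∏ m ∈ (Icc 1 (n * p)).filter (fun m => ¬ p ∣ m), m : ℕ)) : ℚ) =
      aeval t (C (((∏ m ∈ (Icc 1 (n * p)).filter (fun m => ¬ p ∣ m), m : ℕ) : ℤ))) := by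
    rw [aeval_C, algebraMap_int_eq]; simp
  rw [brickPhi, e1, e2, e3, eW, phiNum, phiDen]; simp only [map_mul, map_pow]

/-- The constant term `D(0) = (∏_{p∤ℓ}(ℓ − jp))^A` of the denominator is prime to `p` (`p ≥ 5`). -/
theorem not_dvd_phiDen_coeff_zero (hp : p.Prime) (h3 : 3 < p) (A n : ℕ) (j : ℤ) :
    ¬ (p : ℤ) ∣ (phiDen A p n j).coeff 0 := by
  have hprime : Prime (p : ℤ) := Nat.prime_iff_prime_int.1 hp
  rw [phiDen, coeff_zero_eq_eval_zero, eval_pow, eval_prod]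
  simp only [eval_add, eval_mul, eval_C, eval_X, mul_zero, add_zero]
  intro h
  exact not_dvd_prod_filter_sub_mul hp h3 n j (hprime.dvd_of_dvd_pow h)

end eval

/-! ## Nilpotent bookkeeping (as in `BrickPhiFour`) -/

section nilpotent

variable {R : Type*} [CommRing R] {μ : R}

/-- `∏_{b<n}(1 + x_b μ) = 1 + (Σ_{b<n} x_b)·μ` when `μ² = 0`. [folklore] -/
private theorem prod_one_add_mul (hμ : μ * μ = 0) (x : ℕ → R) (n : ℕ) :
    ∏ b ∈ range n, (1 + x b * μ) = 1 + (∑ b ∈ range n, x b) * μ := by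
  induction n with
  | zero => simp
  | succ n ih =>
    rw [Finset.prod_range_succ, ih, Finset.sum_range_succ]
    linear_combination ((∑ b ∈ range n, x b) * x n) * hμ

/-- `(1 + x μ)^k = 1 + k·x·μ` when `μ² = 0`. [folklore] -/
private theorem one_add_mul_pow (hμ : μ * μ = 0) (x : R) (k : ℕ) :
    (1 + x * μ) ^ k = 1 + (k : R) * x * μ := by
  have h := prod_one_add_mul hμ (fun _ => x) k
  rw [Finset.prod_const, Finset.card_range, Finset.sum_const, Finset.card_range, nsmul_eq_mul] at h
  rw [h]

/-- The assembly identity of `BrickPhiFour` (any commutative ring): with `L² = 0`, `uF = 1`,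
`F·[Fⁿᵃ(1 + a m₀ Lu)]·[FⁿB(1 + B m₁ Lu)]·[FⁿB(1 + B m₂ Lu)] = Fⁿ⁽ᵃ⁺²ᴮ⁾(1 + (a+2B) m₃ Lu)·(F + L·q)`,
`q = a m₀ + B m₁ + B m₂ − (a+2B) m₃` (coefficient `a + 2B` spelled in `R`). [folklore] -/
private theorem assembly {F L u m₀ m₁ m₂ m₃ : R} (hL : L * L = 0) (hu : u * F = 1) (n a B : ℕ) :
    F * ((F ^ n) ^ a * (1 + (a : R) * m₀ * (L * u))) * ((F ^ n) ^ B * (1 + (B : R) * m₁ * (L * u))) *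
        ((F ^ n) ^ B * (1 + (B : R) * m₂ * (L * u))) =
      (F ^ n) ^ (a + 2 * B) * (1 + ((a : R) + 2 * (B : R)) * m₃ * (L * u)) *
        (F + L * ((a : R) * m₀ + B * m₁ + B * m₂ - ((a : R) + 2 * (B : R)) * m₃)) := by
  rw [show (F ^ n) ^ (a + 2 * B) = (F ^ n) ^ a * (F ^ n) ^ B * (F ^ n) ^ B by ring]
  set P : R := (F ^ n) ^ a * (F ^ n) ^ B * (F ^ n) ^ B
  set α : R := (a : R) * m₀
  set β : R := (B : R) * m₁
  set γ : R := (B : R) * m₂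
  set δ : R := ((a : R) + 2 * (B : R)) * m₃
  linear_combination (P * L * (α + β + γ - δ)) * hu +
    (P * (-(δ * (α + β + γ - δ) * u) + F * (α * β + α * γ + β * γ) * u ^ 2 + F * α * β * γ * L * u ^ 3)) * hL

end nilpotent

/-! ## The congruence in `ℤ[T]`, under the polynomial block law modulo `p^k` (`k ≤ 6`) -/

section generic

variable {p k : ℕ}

/-- `Λ_p² ≡ 0 (mod p^k)` for `k ≤ 6` (Wolstenholme: `p² ∣ A_{p−2}`, tree `Wolstenholme.sq_dvd_sum_factorial_div`). -/
private theorem lambda_mul_lambda (hp : p.Prime) (h3 : 3 < p) (hk : k ≤ 6) :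
    ((p * ∑ i ∈ Icc 1 (p - 1), (p - 1)! / i : ℕ) : ZMod (p ^ k)) *
        ((p * ∑ i ∈ Icc 1 (p - 1), (p - 1)! / i : ℕ) : ZMod (p ^ k)) = 0 := by
  obtain ⟨c, hc⟩ := Wolstenholme.sq_dvd_sum_factorial_div hp h3
  have h6 : p ^ 6 = p ^ k * p ^ (6 - k) := by rw [← pow_add, Nat.add_sub_cancel' hk]
  rw [← Nat.cast_mul, ZMod.natCast_eq_zero_iff, hc]
  exact ⟨p ^ (6 - k) * c ^ 2, by
    calc p * (p ^ 2 * c) * (p * (p ^ 2 * c)) = p ^ 6 * c ^ 2 := by ring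
      _ = p ^ k * (p ^ (6 - k) * c ^ 2) := by rw [h6]; ring⟩

/-- `(p−1)!` is a unit modulo `p^k`. -/
private theorem exists_inv_factorial (hp : p.Prime) :
    ∃ u : ZMod (p ^ k), u * (((p - 1)! : ℕ) : ZMod (p ^ k)) = 1 := by
  have hc : Nat.Coprime (p - 1)! (p ^ k) := by
    refine Nat.Coprime.pow_right k (Nat.coprime_comm.1 ((Nat.Prime.coprime_iff_not_dvd hp).2 ?_))
    rw [hp.dvd_factorial]
    have := hp.one_lt
    omega
  exact ⟨(((ZMod.unitOfCoprime _ hc)⁻¹ : (ZMod (p ^ k))ˣ) : ZMod (p ^ k)),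
    by rw [← ZMod.coe_unitOfCoprime _ hc, Units.inv_mul]⟩

/-- `f ↦ 0` in `(ℤ/m)[T]` implies `C m ∣ f` in `ℤ[T]`. [folklore] -/
private theorem C_dvd_of_map_eq_zero {m : ℕ} (f : ℤ[X]) (h : f.map (Int.castRingHom (ZMod m)) = 0) :
    C (m : ℤ) ∣ f := by
  refine (C_dvd_iff_dvd_coeff _ _).2 fun i => (ZMod.intCast_zmod_eq_zero_iff_dvd _ _).1 ?_
  simpa only [coeff_map, eq_intCast, coeff_zero] using congrArg (fun g : (ZMod m)[X] => g.coeff i) h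

/-- One block in `(ℤ/p^k)[T]` under the polynomial block law:
`∏_{0<r<p}(p·q + r) ↦ (p−1)!·(1 + (q² + q)·Λ_p·u)`, `u = ((p−1)!)⁻¹`. -/
private theorem block_map_eq
    (hblock : ∀ q : ℤ[X], C ((p : ℤ) ^ k) ∣
      (∏ i ∈ Icc 1 (p - 1), (X + C (i : ℤ))).comp (C (p : ℤ) * q) - C (((p - 1)! : ℕ) : ℤ) -
        C ((p : ℤ) * ((∑ i ∈ Icc 1 (p - 1), (p - 1)! / i : ℕ) : ℤ)) * (q ^ 2 + q))
    {u : ZMod (p ^ k)} (hu : u * (((p - 1)! : ℕ) : ZMod (p ^ k)) = 1) (q : ℤ[X]) :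
    (∏ i ∈ Icc 1 (p - 1), (C (p : ℤ) * q + C (i : ℤ))).map (Int.castRingHom (ZMod (p ^ k))) =
      C (((p - 1)! : ℕ) : ZMod (p ^ k)) *
        (1 + (q ^ 2 + q).map (Int.castRingHom (ZMod (p ^ k))) *
          (C (((p * ∑ i ∈ Icc 1 (p - 1), (p - 1)! / i : ℕ) : ZMod (p ^ k))) * C u)) := by
  set Ap : ℕ := ∑ i ∈ Icc 1 (p - 1), (p - 1)! / i with hAp
  set F : ℕ := (p - 1)! with hF
  have h := hblock q
  simp only [Polynomial.prod_comp, add_comp, X_comp, C_comp] at h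
  have hmap := Polynomial.map_dvd (Int.castRingHom (ZMod (p ^ k))) h
  have hz : (Int.castRingHom (ZMod (p ^ k))) ((p : ℤ) ^ k) = 0 := by
    rw [map_pow, map_natCast, ← Nat.cast_pow, ZMod.natCast_self]
  rw [Polynomial.map_C, hz, C_0, zero_dvd_iff] at hmap
  simp only [Polynomial.map_sub, Polynomial.map_mul, Polynomial.map_C, Int.coe_castRingHom, Int.cast_natCast,
    Int.cast_mul] at hmap
  have hu' : C u * C ((F : ZMod (p ^ k))) = 1 := by rw [← C_mul, hu, C_1]
  push_cast
  linear_combination hmap - ((q ^ 2 + q).map (Int.castRingHom (ZMod (p ^ k))) *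
    C ((p : ZMod (p ^ k)) * (Ap : ZMod (p ^ k)))) * hu'

/-- The four products of `Φ_{n,p}(−j+T)` as blocks in `(ℤ/p^k)[T]`:
`∏_{1≤ℓ≤np, p∤ℓ}(p·c + ℓ) ↦ ((p−1)!)ⁿ·(1 + M_n(c)·Λ_p·u)` for every `c ∈ ℤ[T]`. -/
private theorem prod_filter_map_eq (hp : p.Prime) (h3 : 3 < p) (hk : k ≤ 6)
    (hblock : ∀ q : ℤ[X], C ((p : ℤ) ^ k) ∣
      (∏ i ∈ Icc 1 (p - 1), (X + C (i : ℤ))).comp (C (p : ℤ) * q) - C (((p - 1)! : ℕ) : ℤ) -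
        C ((p : ℤ) * ((∑ i ∈ Icc 1 (p - 1), (p - 1)! / i : ℕ) : ℤ)) * (q ^ 2 + q))
    {u : ZMod (p ^ k)} (hu : u * (((p - 1)! : ℕ) : ZMod (p ^ k)) = 1) (n : ℕ) (c : ℤ[X]) :
    (∏ m ∈ (Icc 1 (n * p)).filter (fun m => ¬ p ∣ m), (C (p : ℤ) * c + C (m : ℤ))).map
        (Int.castRingHom (ZMod (p ^ k))) =
      C (((p - 1)! : ℕ) : ZMod (p ^ k)) ^ n *
        (1 + (blockMomentX n c).map (Int.castRingHom (ZMod (p ^ k))) *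
          (C (((p * ∑ i ∈ Icc 1 (p - 1), (p - 1)! / i : ℕ) : ZMod (p ^ k))) * C u)) := by
  have hμ : (C (((p * ∑ i ∈ Icc 1 (p - 1), (p - 1)! / i : ℕ) : ZMod (p ^ k))) * C u) *
      (C (((p * ∑ i ∈ Icc 1 (p - 1), (p - 1)! / i : ℕ) : ZMod (p ^ k))) * C u) = 0 := by
    rw [← map_mul, ← map_mul, ← map_zero Polynomial.C]; congr 1
    linear_combination (u * u) * lambda_mul_lambda hp h3 hk
  rw [prod_filter_not_dvd_eq_prod_prod hp.pos n (fun m => C (p : ℤ) * c + C (m : ℤ)), Polynomial.map_prod]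
  have hb : ∀ b ∈ range n,
      (∏ r ∈ Icc 1 (p - 1), (C (p : ℤ) * c + C ((b * p + r : ℕ) : ℤ))).map (Int.castRingHom (ZMod (p ^ k))) =
        C (((p - 1)! : ℕ) : ZMod (p ^ k)) *
          (1 + ((c + C (b : ℤ)) ^ 2 + (c + C (b : ℤ))).map (Int.castRingHom (ZMod (p ^ k))) *
            (C (((p * ∑ i ∈ Icc 1 (p - 1), (p - 1)! / i : ℕ) : ZMod (p ^ k))) * C u)) := by
    intro b _
    have e : ∏ r ∈ Icc 1 (p - 1), (C (p : ℤ) * c + C ((b * p + r : ℕ) : ℤ)) =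
        ∏ r ∈ Icc 1 (p - 1), (C (p : ℤ) * (c + C (b : ℤ)) + C (r : ℤ)) :=
      Finset.prod_congr rfl fun r _ => by rw [Nat.cast_add, Nat.cast_mul, map_add, map_mul]; ring
    rw [e]; exact block_map_eq hblock hu (c + C (b : ℤ))
  have hsum : ∑ b ∈ range n, ((c + C (b : ℤ)) ^ 2 + (c + C (b : ℤ))).map (Int.castRingHom (ZMod (p ^ k))) =
      (blockMomentX n c).map (Int.castRingHom (ZMod (p ^ k))) := by
    rw [blockMomentX, Polynomial.map_sum]
    exact Finset.sum_congr rfl fun b _ => by congr 1; ring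
  rw [Finset.prod_congr rfl hb, Finset.prod_mul_distrib, Finset.prod_const, Finset.card_range,
    prod_one_add_mul hμ (fun b => ((c + C (b : ℤ)) ^ 2 + (c + C (b : ℤ))).map (Int.castRingHom (ZMod (p ^ k)))) n,
    hsum]

/-- **The congruence in `ℤ[T]` under the polynomial block law modulo `p^k`, `k ≤ 6`**: for a prime `p ≥ 5` with
`∏_{0<r<p}(pq + r) ≡ (p−1)! + (q²+q)·Λ_p (mod p^kℤ[T])` for all `q ∈ ℤ[T]`, `2B ≤ A`, every `n`, every `j ∈ ℤ`:
`C(p^k) ∣ (p−1)!·N − D·((p−1)! + Λ_p·Q)` in `ℤ[T]` (`N = phiNum`, `D = phiDen`, `Q = phiMomentX`). -/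
theorem C_dvd_phiNum_sub_of_block (hp : p.Prime) (h3 : 3 < p) (hk : k ≤ 6)
    (hblock : ∀ q : ℤ[X], C ((p : ℤ) ^ k) ∣
      (∏ i ∈ Icc 1 (p - 1), (X + C (i : ℤ))).comp (C (p : ℤ) * q) - C (((p - 1)! : ℕ) : ℤ) -
        C ((p : ℤ) * ((∑ i ∈ Icc 1 (p - 1), (p - 1)! / i : ℕ) : ℤ)) * (q ^ 2 + q))
    {A B : ℕ} (hAB : 2 * B ≤ A) (n : ℕ) (j : ℤ) :
    C ((p : ℤ) ^ k) ∣
      C (((p - 1)! : ℕ) : ℤ) * phiNum A B p n j -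
        phiDen A p n j * (C (((p - 1)! : ℕ) : ℤ) +
          C (((p * ∑ i ∈ Icc 1 (p - 1), (p - 1)! / i : ℕ) : ℤ)) * phiMomentX A B n j) := by
  obtain ⟨a, rfl⟩ : ∃ a, A = a + 2 * B := ⟨A - 2 * B, by omega⟩
  obtain ⟨u, hu⟩ := exists_inv_factorial (p := p) (k := k) hp
  rw [(Nat.cast_pow p k).symm]
  refine C_dvd_of_map_eq_zero _ ?_
  have eW : C (((∏ m ∈ (Icc 1 (n * p)).filter (fun m => ¬ p ∣ m), m : ℕ) : ℤ)) =
      ∏ m ∈ (Icc 1 (n * p)).filter (fun m => ¬ p ∣ m), (C (p : ℤ) * 0 + C (m : ℤ)) := by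
    rw [Nat.cast_prod, map_prod]
    exact Finset.prod_congr rfl fun m _ => by ring
  have e1 : ∏ m ∈ (Icc 1 (n * p)).filter (fun m => ¬ p ∣ m), (C (j * p + (m : ℤ)) - C (p : ℤ) * X) =
      ∏ m ∈ (Icc 1 (n * p)).filter (fun m => ¬ p ∣ m), (C (p : ℤ) * (C j - X) + C (m : ℤ)) :=
    Finset.prod_congr rfl fun m _ => by rw [map_add, map_mul]; ring
  have e2 : ∏ m ∈ (Icc 1 (n * p)).filter (fun m => ¬ p ∣ m), (C (((n : ℤ) - j) * p + (m : ℤ)) + C (p : ℤ) * X) =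
      ∏ m ∈ (Icc 1 (n * p)).filter (fun m => ¬ p ∣ m), (C (p : ℤ) * (C ((n : ℤ) - j) + X) + C (m : ℤ)) :=
    Finset.prod_congr rfl fun m _ => by rw [map_add, map_mul]; ring
  have e3 : ∏ m ∈ (Icc 1 (n * p)).filter (fun m => ¬ p ∣ m), (C ((m : ℤ) - j * p) + C (p : ℤ) * X) =
      ∏ m ∈ (Icc 1 (n * p)).filter (fun m => ¬ p ∣ m), (C (p : ℤ) * (X - C j) + C (m : ℤ)) :=
    Finset.prod_congr rfl fun m _ => by rw [map_sub, map_mul]; ring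
  rw [phiNum, phiDen, eW, e1, e2, e3]
  have hL : ((p : (ZMod (p ^ k))[X]) * ((∑ i ∈ Icc 1 (p - 1), (p - 1)! / i : ℕ) : (ZMod (p ^ k))[X])) *
      ((p : (ZMod (p ^ k))[X]) * ((∑ i ∈ Icc 1 (p - 1), (p - 1)! / i : ℕ) : (ZMod (p ^ k))[X])) = 0 := by
    simpa only [map_mul, map_zero, map_natCast, Nat.cast_mul] using
      congrArg (Polynomial.C : ZMod (p ^ k) → (ZMod (p ^ k))[X]) (lambda_mul_lambda hp h3 hk)
  have hμ : ((p : (ZMod (p ^ k))[X]) * ((∑ i ∈ Icc 1 (p - 1), (p - 1)! / i : ℕ) : (ZMod (p ^ k))[X]) * C u) *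
      ((p : (ZMod (p ^ k))[X]) * ((∑ i ∈ Icc 1 (p - 1), (p - 1)! / i : ℕ) : (ZMod (p ^ k))[X]) * C u) = 0 := by
    linear_combination (C u * C u) * hL
  have hu' : C u * (((p - 1)! : ℕ) : (ZMod (p ^ k))[X]) = 1 := by
    simpa only [map_mul, map_one, map_natCast] using congrArg (Polynomial.C : ZMod (p ^ k) → (ZMod (p ^ k))[X]) hu
  simp only [Polynomial.map_sub, Polynomial.map_mul, Polynomial.map_pow, Polynomial.map_add, Polynomial.map_C,
    prod_filter_map_eq hp h3 hk hblock hu]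
  simp only [phiMomentX, Polynomial.map_sub, Polynomial.map_mul, Polynomial.map_add, Polynomial.map_C]
  simp only [Nat.cast_mul, map_mul, map_natCast, Nat.add_sub_cancel, mul_pow]
  simp only [one_add_mul_pow hμ]
  simp only [Nat.cast_add, Nat.cast_mul, Nat.cast_ofNat]
  linear_combination assembly
    (m₀ := (blockMomentX n 0).map (Int.castRingHom (ZMod (p ^ k))))
    (m₁ := (blockMomentX n (C j - X)).map (Int.castRingHom (ZMod (p ^ k))))
    (m₂ := (blockMomentX n (C ((n : ℤ) - j) + X)).map (Int.castRingHom (ZMod (p ^ k))))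
    (m₃ := (blockMomentX n (X - C j)).map (Int.castRingHom (ZMod (p ^ k)))) hL hu' n a B

end generic

/-! ## The instances: modulo `p⁴` (`p ≥ 5`, Glaisher) and modulo `p⁵` (`p ≥ 7`, Zhao) -/

section instances

variable {p : ℕ}

/-- **LEMMA Φ4 coefficientwise**: for a prime `p ≥ 5`, `2B ≤ A`, every `n`, every `j ∈ ℤ`:
`(p−1)!·N(T) ≡ D(T)·((p−1)! + Λ_p·Q(T)) (mod p⁴ℤ[T])`, `Q(T) = q_n(j) + (A−2B)·n·T·(2j−n−T)` — i.e.
`Φ_{n,p}(−j+T) ≡ 1 + λ_p·Q(T) (mod p⁴)` in `ℤ_(p)[[T]]`, `λ_p = p·H_{p−1}`. -/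
theorem C_pow_four_dvd_phiNum_sub (hp : p.Prime) (h3 : 3 < p) {A B : ℕ} (hAB : 2 * B ≤ A) (n : ℕ) (j : ℤ) :
    C ((p : ℤ) ^ 4) ∣
      C (((p - 1)! : ℕ) : ℤ) * phiNum A B p n j -
        phiDen A p n j * (C (((p - 1)! : ℕ) : ℤ) +
          C (((p * ∑ i ∈ Icc 1 (p - 1), (p - 1)! / i : ℕ) : ℤ)) * phiMomentX A B n j) :=
  C_dvd_phiNum_sub_of_block hp h3 (by norm_num) (Ljunggren.block_congruence_pow_four hp h3) hAB n j

/-- **LEMMA Φ5 coefficientwise** (`p ≥ 7`): the same congruence modulo `p⁵ℤ[T]` (Zhao's block law, tree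
`Ljunggren.block_congruence_pow_five`). -/
theorem C_pow_five_dvd_phiNum_sub (hp : p.Prime) (h5 : 5 < p) {A B : ℕ} (hAB : 2 * B ≤ A) (n : ℕ) (j : ℤ) :
    C ((p : ℤ) ^ 5) ∣
      C (((p - 1)! : ℕ) : ℤ) * phiNum A B p n j -
        phiDen A p n j * (C (((p - 1)! : ℕ) : ℤ) +
          C (((p * ∑ i ∈ Icc 1 (p - 1), (p - 1)! / i : ℕ) : ℤ)) * phiMomentX A B n j) :=
  C_dvd_phiNum_sub_of_block hp (by omega) (by norm_num) (Ljunggren.block_congruence_pow_five hp h5) hAB n j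

/-- **THEOREM 2 (ii) coefficientwise** (zi-p2 LEMMAS §B8-a; THEOREM 5 Step B's input «φ_m ∈ p³ℤ_(p), m ≥ 1»): for a
prime `p ≥ 5`, `2B ≤ A`, every `n`, every `j ∈ ℤ`: `N(T) ≡ D(T) (mod p³ℤ[T])`, i.e. `Φ_{n,p}(−j+T) ≡ 1 (mod p³)` in
`ℤ_(p)[[T]]` (`D(0)` is a `p`-unit, `not_dvd_phiDen_coeff_zero`). -/
theorem C_pow_three_dvd_phiNum_sub_phiDen (hp : p.Prime) (h3 : 3 < p) {A B : ℕ} (hAB : 2 * B ≤ A) (n : ℕ)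
    (j : ℤ) : C ((p : ℤ) ^ 3) ∣ phiNum A B p n j - phiDen A p n j := by
  obtain ⟨c, hc⟩ := Wolstenholme.sq_dvd_sum_factorial_div hp h3
  obtain ⟨G, hG⟩ := C_pow_four_dvd_phiNum_sub hp h3 hAB n j
  -- `(p−1)!·(N − D) = p³·(p·G + c·D·Q)`
  have hF : C (((p - 1)! : ℕ) : ℤ) * (phiNum A B p n j - phiDen A p n j) =
      C ((p : ℤ) ^ 3) * (C (p : ℤ) * G + C (c : ℤ) * phiDen A p n j * phiMomentX A B n j) := by
    rw [hc] at hG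
    push_cast at hG
    simp only [map_mul, map_pow, map_natCast] at hG ⊢
    linear_combination hG
  refine (C_dvd_iff_dvd_coeff _ _).2 fun i => ?_
  have hi := congrArg (fun g : ℤ[X] => g.coeff i) hF
  simp only [coeff_C_mul] at hi
  have hdvd : (p : ℤ) ^ 3 ∣ (((p - 1)! : ℕ) : ℤ) * (phiNum A B p n j - phiDen A p n j).coeff i := ⟨_, hi⟩
  refine (IsCoprime.pow_left ?_).dvd_of_dvd_mul_left hdvd
  rw [Int.isCoprime_iff_gcd_eq_one, Int.gcd_comm]
  exact_mod_cast (Nat.coprime_comm.1 ((Nat.Prime.coprime_iff_not_dvd hp).2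
    (by rw [hp.dvd_factorial]; have := hp.one_lt; omega)) : Nat.Coprime (p - 1)! p)

end instances

end

end Summit.KontsevichZagierPeriods.Zeta5Search.BrickPhiTaylor
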